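import Summits.ABC.IUTFork.Repair.EvalI06StarGenuine
import Summits.ABC.IUTFork.Repair.RHAvgSlackNonneg
import Literature.IUT.LogVolume.LogRadiusClosedForm
import HarnessLib

/-!
# D-0079 RESCUE sub-cell R-H, ROUND 1 (D-0107), PAIR n = 7 — `RHShellCapacityPlus`: the candidate H⋆₇ «shell-capacity-plus» TYPED as a
# deciding declaration over the genuine pilot-datum currency (`Cor312Prov.pilotDataOfK D K`, realising ideles, the real log-shell `ℐ_x`)

[R-H candidate — a HYPOTHESIS, claim-tagged `def … : Prop`; never a Literature fact; typed ≠ proved; instantiated ≠ endorsed.] Seat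
abc-iut-rh-typ-7 gen 0 (TYPER of pair 7; tester abc-iut-rh-tst-7; k2 desk hand abc-iut-rp-j2 g4; lead abc-iut-rh-lead g0). TAKES NO SIDE on
[IUTchIII] Cor. 3.12 or on any author; nothing here asserts abc proved or refuted.

ROW 7 OF `plan/rescue/R-H/RH-CANDIDATES.tsv` (v1 f7773e15cd7f6906, one writer abc-iut-rh-lead g0), VERBATIM: slug `shell-capacity-plus`; author
«lens-transfer-2 (price the deep stratum by log_p(e_w): Neron/Tate local height vs [IUTchIV] Prop 1.2 exponent b ~ log_p e)»; informal statement
«forall bad w, j: h(w,j) <= kappa_plus(w) = c + b_e = c + floor(log_p(p*e_w/(p-1))) - 1/e_w (I06* read with the NECESSARY-side shell radius; the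
most generous shell-internal capacity)»; scope «all packets»; cut class «C3 / G1 G3»; k1 recipe «slack_plus >= 0 per cell (column); sharp variant:
kappa_plus_sharp(p454995)»; k2 door «none needed if KILLED at k1; (if kept on a sub-family: H* is NECESSARY for I06*, not sufficient for anything —
k2 FAILS by design)».

THE TYPING (column vocabulary of `plan/rescue/R-H/I06STAR-COLUMNS.tsv` v1 2e4c48fd4267a5a7 ↔ the tree). At a bad place `x | p` of a pilot datum `X`
(abc-iut-c312-7's `Thm311.Real` fibre point `x`, `placeOf X p x ∈ X.S`) with absolute ramification index `e_x = e(x|p)` and q-order `ord_x(q) =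
X.ordq (placeOf X p x)` (so the table's `H = ord_p(q_E) = ord_x(q)/e_x`), the table's demand at label `j = i+1 ∈ 𝔽_l^⋇` is `h(x,j) = (j²−1)·H/(2l) =
(j²−1)·ord_x(q)/(2l·e_x)`, and its NECESSARY-side capacity is `κ⁺(x) = b_{e_x} + c` with `b_e = logRadiusB p e = ⌊log_p(p·e/(p−1))⌋ − 1/e` ([IUTchIV]
Prop. 1.2, abc-iut-S1's `Literature.IUT.LogVolume.logRadiusB`) and `c = ord_p(p*) ∈ {1, 2}`. H⋆₇ is the cell `h(x,j) ≤ κ⁺(x)` at EVERY bad place and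
EVERY label, cleared of denominators: **`HStarShellCapacityPlus X`** := `∀ p, i, x bad: ((i+1)² − 1)·ord_x(q) ≤ 2l·e_x·(b_{e_x} + c)` (§2). It is
exactly the conclusion of abc-iut-rp-x3's upper-window lemma `EvalI06StarGenuine.heights_le_of_mem_smul_logShell` (p456100), i.e. the I06⋆ cell
`t_{q,x} ∈ t_{Θ,j,x}·ℐ_x` READ WITH THE CIRCUMSCRIBED BALL `‖p*‖⁻¹·p^{b_e} ⊇ ℐ_x` of [IUTchIV] Prop. 1.2 (i) in place of the shell (§4: the
element-level equivalent `t_{q,x} ∈ t_{Θ,j,x} · closedBall 0 (‖p*‖⁻¹·p^{b_{e_x}})`).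

WHAT IS PROVED (namespace `Summit.ABC.IUTFork.Repair.RH.ShellCapacityPlus`; 0 sorry; standard axioms):
* §1 integer currency BY NAME from abc-iut-rh-typ-11's `RHAvgSlackNonneg` (p457626: `eFloorLog`, `cExp`, `capPlusW`, `slackPlusW2l`; nothing
  re-declared): **`logRadiusB_eq_eFloorLog`** (`b_e = Nat.log p (p·e/(p−1)) − 1/e`, one formula on every stratum, from abc-iut-rp-x2's window lemma
  `logRadiusB_eq_of_window`) and **`mul_kappaPlus_eq_capPlusW`**: `e·(b_e + c) = capPlusW p e`;
* §2 the candidate `CellPlus` / **`HStarShellCapacityPlus`** and its INTEGER DECIDERS **`cellPlus_iff_int`** (`((i+1)² − 1)·ord_x(q) ≤ 2l·capPlusW p e_x`)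
  and **`cellPlus_iff_slackPlus_nonneg`** (`CellPlus ⟺ 0 ≤ slackPlusW2l p e_x ord_x(q) l (i+1)` — the k1 recipe «slack_plus >= 0 per cell» literally);
* §3 NECESSITY (the row's «H* is NECESSARY for I06*»): for REALISING Θ- and q-ideles, the I06⋆ cell at `(x, j)` in either tree reading —
  abc-iut-rp-x3's `t_{q,x} ∈ t_{Θ,j,x}·ℐ_x` (**`cellPlus_of_mem_thetaIdele_smul`**) or abc-iut-rp-d2 / w5-d068's `t_{q,x} ∈ t_{q,x}^{j²}·ℐ_x`
  (**`cellPlus_of_mem_pow_smul`**) — IMPLIES the H⋆₇ cell; hence **`hStar_of_realStar`**; contrapositive **`not_mem_of_not_cellPlus`** = the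
  table's DECIDED-NEG engine (every H⋆₇-NEG cell is an I06⋆-NEG cell);
* §4 FAITHFULNESS: **`cellPlus_iff_mem_thetaIdele_smul_closedBall`** — H⋆₇'s cell IS the I06⋆ cell with `ℐ_x` replaced by its circumscribed ball;
* §5 the same AT `pilotDataOfK D K` (`ord_x(q) = e(x|v)·ord_v(q_v)`, `Cor312Prov.ordq_pilotDataOfK`): **`cellPlus_pilotDataOfK_iff_int`**,
  **`hStar_pilotDataOfK_of_realStar`**;
* §6 k1 kernel witnesses for the named separating cells of I06STAR-COLUMNS v1 (lamSeven `k = 1` vs `k = 2` at `l = 11`, `e_w = 55`, top label).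
k1 OF RECORD (seat-side exact rationals on all 1376 cell rows of v1 2e4c48fd4267a5a7, evaluator reproducing the table's own 1376 cells and 256
lamSeven datum verdicts with 0 mismatches): datum HOLDS iff every cell has `slack_plus ≥ 0` — lamSeven G-HEX 10/256 = 3.9 % (exactly the ten
I06⋆-OPEN `k = 1` data; by construction H⋆₇-HOLDS = I06⋆ ∈ {POS, OPEN}), HEX strip 47/272 (datum, local type) groups = 17.3 % (l = 5: 25/64, l = 7: 12/64,
l = 11: 5/72, l = 13: 5/72), concrete 2/4 (S-X75, S-X75i hold; S-X72, S-RAT fail); pooled 59/532 = 11.1 % < 95 % ⇒ k1 = FAIL by the verbatim rule of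
START-HERE §3. READING (neutral): H⋆₇ is the weakest member of the «re-price the one shell» family (rows 7, 10): no shell-internal re-pricing can
hold on more than the I06⋆-non-NEG rows, 10/256 of G-HEX. [cite: Mochizuki2012, IUTchI Def. 3.1 (b)(c) p. 61, Ex. 3.2 (iv) p. 71; IUTchIV Prop. 1.2 (i) p. 10]
[cite: MochizukiAbsTopIII2015, Def 5.4 (iii) p. 126] [cite: DupuyHilado2025, §3.3, §3.4] [claim: Mochizuki2012, status: disputed] for every IUT
sentence quoted.
-/

noncomputable section

open Set Metric Function NumberField IsDedekindDomain
open scoped Pointwise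

namespace Summit.ABC.IUTFork.Repair.RH.ShellCapacityPlus

open Literature.AnabelianGeometry.AbsoluteAnabelian Literature.IUT.LogThetaLattice Literature.IUT.LogVolume
  Summit.ABC.IUTFork.Repair.CandInternal2Real Summit.ABC.IUTFork.Repair.CandInternal2RealLabels
  Summit.ABC.IUTFork.Repair.EvalI06StarGenuine

/-! ## §1. Integer currency BY NAME (abc-iut-rh-typ-11's `RHAvgSlackNonneg`, p457626): `e·κ⁺ = e·(b_e + c) = capPlusW p e` -/

/-- **`b_e = ⌊log_p(p·e/(p−1))⌋ − 1/e` with the floor as abc-iut-rh-typ-11's `eFloorLog p e = Nat.log p (p·e/(p−1))`** — ONE formula on every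
stratum (tame, boundary, deep; `p = 2` included), for a prime `p` and `e ≥ 1`: the real floor of [IUTchIV] Prop. 1.2's `b` is the `Nat.log` of the
natural-number quotient (abc-iut-rp-x2's window lemma `logRadiusB_eq_of_window`). [cite: Mochizuki2012, IUTchIV Prop. 1.2 p. 10] -/
theorem logRadiusB_eq_eFloorLog {p e : ℕ} (hp : 1 < p) (he : 1 ≤ e) :
    logRadiusB p e = (RHAvgSlackNonneg.eFloorLog p e : ℝ) - 1 / e := by
  have hn : 0 < p - 1 := by omega
  have hpe : p - 1 ≤ p * e := le_trans (Nat.sub_le p 1) (Nat.le_mul_of_pos_right p (by omega))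
  have hm0 : p * e / (p - 1) ≠ 0 := (Nat.div_pos hpe hn).ne'
  have h1 : p ^ Nat.log p (p * e / (p - 1)) * (p - 1) ≤ p * e :=
    (Nat.le_div_iff_mul_le hn).1 (Nat.pow_log_le_self p hm0)
  have h2 : p * e < p ^ (Nat.log p (p * e / (p - 1)) + 1) * (p - 1) :=
    (Nat.div_lt_iff_lt_mul hn).1 (Nat.lt_pow_succ_log_self hp _)
  unfold RHAvgSlackNonneg.eFloorLog
  exact logRadiusB_eq_of_window hp he h1 h2

/-- **`e·(b_e + c) = capPlusW p e`** (abc-iut-rh-typ-11's NECESSARY shell capacity in `w`-units, `e·c + e·⌊log_p(p·e/(p−1))⌋ − 1`) for a prime `p`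
and `e ≥ 1`. [cite: Mochizuki2012, IUTchIV Prop. 1.2 (i) p. 10] -/
theorem mul_kappaPlus_eq_capPlusW {p e : ℕ} (hp : p.Prime) (he : 1 ≤ e) :
    (e : ℝ) * (logRadiusB p e + ((if p = 2 then 2 else 1 : ℕ) : ℝ)) = (RHAvgSlackNonneg.capPlusW p e : ℝ) := by
  show (e : ℝ) * (logRadiusB p e + ((RHAvgSlackNonneg.cExp p : ℕ) : ℝ)) = _
  rw [logRadiusB_eq_eFloorLog hp.one_lt he]
  unfold RHAvgSlackNonneg.capPlusW
  have he0 : (e : ℝ) ≠ 0 := by exact_mod_cast (show e ≠ 0 by omega)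
  push_cast
  field_simp
  ring

/-! ## §2. The candidate H⋆₇ over a pilot datum, and its integer decider -/

section Candidate

open Thm311 Thm311.Real Cor312 Cor312Vol Cor312Prov

variable {F : Type} [Field F] [NumberField F] (X : PilotData F)

/-- **H⋆₇'s CELL at a bad place `x | p` and label `j = i+1`: `h(x,j) ≤ κ⁺(x)`**, i.e. `((i+1)² − 1)·ord_x(q) ≤ 2l·e_x·(b_{e_x} + c)` — the table's
`slack_plus ≥ 0`, «I06* read with the NECESSARY-side shell radius». A claim-tagged hypothesis; asserts nothing.
[cite: Mochizuki2012, IUTchIV Prop. 1.2 (i) p. 10] [claim: Mochizuki2012, status: disputed] -/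
@[claim "Mochizuki2012" "disputed"]
def CellPlus (pp : Nat.Primes) (i : Fin X.lstar) (x : (thetaIndex X).Fibre (.inr pp)) : Prop :=
  haveI : Fact (pp : ℕ).Prime := ⟨pp.2⟩
  ((((i : ℕ) : ℝ) + 1) ^ 2 - 1) * (X.ordq (placeOf X pp.1 x) : ℝ) ≤
    2 * X.l * ((placeOf X pp.1 x).asIdeal.ramificationIdx ℤ : ℝ) *
      (logRadiusB pp ((placeOf X pp.1 x).asIdeal.ramificationIdx ℤ) + ((if (pp : ℕ) = 2 then 2 else 1 : ℕ) : ℝ))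

/-- **H⋆₇ «shell-capacity-plus»** (row 7 of RH-CANDIDATES v1): «forall bad w, j: h(w,j) <= kappa_plus(w) = c + b_e = c + floor(log_p(p*e_w/(p-1))) -
1/e_w» — the cell `CellPlus` at EVERY bad place `x` of the pilot datum `X` and EVERY label `j = i+1 ∈ 𝔽_l^⋇`. A claim-tagged HYPOTHESIS over the
genuine currency (instantiate `X := Cor312Prov.pilotDataOfK D K`, §5); never asserted. [cite: Mochizuki2012, IUTchIV Prop. 1.2 (i) p. 10]
[claim: Mochizuki2012, status: disputed] -/
@[claim "Mochizuki2012" "disputed"]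
def HStarShellCapacityPlus : Prop :=
  ∀ (pp : Nat.Primes) (i : Fin X.lstar) (x : (thetaIndex X).Fibre (.inr pp)),
    haveI : Fact (pp : ℕ).Prime := ⟨pp.2⟩
    placeOf X pp.1 x ∈ X.S → CellPlus X pp i x

/-- **k1 DECIDER, integer form**: `CellPlus ⟺ ((i+1)² − 1)·ord_x(q) ≤ 2l·capPlusW p e_x` in `ℤ` (`(j²−1)·H ≤ 2l·κ⁺` with `H = ord_x(q)/e_x`,
denominators cleared; `capPlusW` = abc-iut-rh-typ-11's `e·κ⁺`). [cite: Mochizuki2012, IUTchIV Prop. 1.2 (i) p. 10] -/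
theorem cellPlus_iff_int (pp : Nat.Primes) [Fact (pp : ℕ).Prime] (i : Fin X.lstar) (x : (thetaIndex X).Fibre (.inr pp)) :
    CellPlus X pp i x ↔
      ((((i : ℕ) : ℤ) + 1) ^ 2 - 1) * X.ordq (placeOf X pp.1 x) ≤
        2 * X.l * RHAvgSlackNonneg.capPlusW pp ((placeOf X pp.1 x).asIdeal.ramificationIdx ℤ) := by
  have he1 : 1 ≤ (placeOf X pp.1 x).asIdeal.ramificationIdx ℤ := Ideal.ramificationIdx_pos _ _
  have key : 2 * (X.l : ℝ) * ((placeOf X pp.1 x).asIdeal.ramificationIdx ℤ : ℝ) *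
      (logRadiusB pp ((placeOf X pp.1 x).asIdeal.ramificationIdx ℤ) + ((if (pp : ℕ) = 2 then 2 else 1 : ℕ) : ℝ)) =
        2 * (X.l : ℝ) * (RHAvgSlackNonneg.capPlusW pp ((placeOf X pp.1 x).asIdeal.ramificationIdx ℤ) : ℝ) := by
    rw [mul_assoc, mul_kappaPlus_eq_capPlusW pp.2 he1]
  unfold CellPlus
  rw [key]
  constructor
  · intro h; exact_mod_cast h
  · intro h; exact_mod_cast h

/-- **k1 DECIDER = THE COLUMN `slack_plus ≥ 0`** (row 7's k1 recipe verbatim «slack_plus >= 0 per cell (column)»): `CellPlus ⟺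
0 ≤ slackPlusW2l p e_x ord_x(q) l (i+1)`, abc-iut-rh-typ-11's necessary cell slack in `w`-units × `2l` (`2l·capPlusW − (j²−1)·ord_w(q)`).
[cite: Mochizuki2012, IUTchIV Prop. 1.2 (i) p. 10] -/
theorem cellPlus_iff_slackPlus_nonneg (pp : Nat.Primes) [Fact (pp : ℕ).Prime] (i : Fin X.lstar) (x : (thetaIndex X).Fibre (.inr pp)) :
    CellPlus X pp i x ↔
      0 ≤ RHAvgSlackNonneg.slackPlusW2l pp ((placeOf X pp.1 x).asIdeal.ramificationIdx ℤ) (X.ordq (placeOf X pp.1 x)) X.l ((i : ℕ) + 1) := by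
  rw [cellPlus_iff_int, RHAvgSlackNonneg.slackPlusW2l, sub_nonneg]
  push_cast
  exact Iff.rfl

/-- The demand is monotone in the label, so **H⋆₇ at a place is decided at the TOP label `j = l⋆`**: `CellPlus` at `i+1 = l⋆` ⟹ `CellPlus` at every
label (`ord_x(q) > 0` at a bad place). [folklore] -/
theorem cellPlus_of_top (pp : Nat.Primes) [Fact (pp : ℕ).Prime] (i : Fin X.lstar) (x : (thetaIndex X).Fibre (.inr pp))
    (hx : placeOf X pp.1 x ∈ X.S) (htop : CellPlus X pp ⟨X.lstar - 1, by have := X.two_le_lstar; omega⟩ x) : CellPlus X pp i x := by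
  unfold CellPlus at htop ⊢
  have hord : (0 : ℝ) ≤ (X.ordq (placeOf X pp.1 x) : ℝ) := by exact_mod_cast (X.ordq_pos hx).le
  have hi : (((i : ℕ) : ℝ) + 1) ≤ (((X.lstar - 1 : ℕ) : ℝ) + 1) := by
    have h := i.2
    have h2 := X.two_le_lstar
    have : (i : ℕ) ≤ X.lstar - 1 := by omega
    exact_mod_cast Nat.succ_le_succ this
  have hi0 : (0 : ℝ) ≤ ((i : ℕ) : ℝ) + 1 := by positivity
  have hsq : (((i : ℕ) : ℝ) + 1) ^ 2 - 1 ≤ (((X.lstar - 1 : ℕ) : ℝ) + 1) ^ 2 - 1 := by nlinarith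
  calc ((((i : ℕ) : ℝ) + 1) ^ 2 - 1) * (X.ordq (placeOf X pp.1 x) : ℝ)
      ≤ ((((X.lstar - 1 : ℕ) : ℝ) + 1) ^ 2 - 1) * (X.ordq (placeOf X pp.1 x) : ℝ) := by gcongr
    _ ≤ _ := by simpa using htop

end Candidate

/-! ## §3. NECESSITY: the I06⋆ cell (either tree reading) implies H⋆₇'s cell -/

section Realising

open Thm311 Thm311.Real Cor312 Cor312Vol Cor312Prov

variable {F : Type} [Field F] [NumberField F] (X : PilotData F)
  (t : ∀ (pp : Nat.Primes) (_ : Fin X.lstar) (x : (thetaIndex X).Fibre (.inr pp)),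
    haveI : Fact (pp : ℕ).Prime := ⟨pp.2⟩; kOf X pp.1 x)
  (ht0 : ∀ pp i x, t pp i x ≠ 0)
  (ht : ∀ (pp : Nat.Primes) (i : Fin X.lstar) (x : (thetaIndex X).Fibre (.inr pp)),
    haveI : Fact (pp : ℕ).Prime := ⟨pp.2⟩
    Real.log ‖t pp i x‖ = -(X.thetaPilot i (placeOf X pp.1 x)) * logNorm F (placeOf X pp.1 x) /
      localDegree F (placeOf X pp.1 x))
  (tq : ∀ (pp : Nat.Primes) (x : (thetaIndex X).Fibre (.inr pp)), haveI : Fact (pp : ℕ).Prime := ⟨pp.2⟩; kOf X pp.1 x)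
  (htq0 : ∀ pp x, tq pp x ≠ 0)
  (htq : ∀ (pp : Nat.Primes) (x : (thetaIndex X).Fibre (.inr pp)),
    haveI : Fact (pp : ℕ).Prime := ⟨pp.2⟩
    Real.log ‖tq pp x‖ = -(X.qPilot (placeOf X pp.1 x)) * logNorm F (placeOf X pp.1 x) /
      localDegree F (placeOf X pp.1 x))

/-- `e(K_x/ℚ_p) = e(x|p)`: the absolute ramification index of the rescaled completion is the datum-side index. [folklore] -/
theorem absRamificationIdx_kOf (pp : Nat.Primes) [Fact (pp : ℕ).Prime] (x : (thetaIndex X).Fibre (.inr pp)) :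
    absRamificationIdx pp (kOf X pp.1 x) = (placeOf X pp.1 x).asIdeal.ramificationIdx ℤ :=
  absRamificationIdx_rescaledCompletion F pp.1 (placeOf X pp.1 x) (natCast_mem_placeOf X pp.1 x)

include ht0 ht htq0 htq in
/-- **NECESSITY, abc-iut-rp-x3's reading**: for REALISING ideles, the I06⋆ cell `t_{q,x} ∈ t_{Θ,i+1,x}·ℐ_x` at a bad place IMPLIES H⋆₇'s cell
`((i+1)² − 1)·ord_x(q) ≤ 2l·e_x·(b_{e_x} + c)` (`EvalI06StarGenuine.heights_le_of_mem_smul_logShell`, [IUTchIV] Prop. 1.2 (i) upper inclusion).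
«H* is NECESSARY for I06*». [cite: MochizukiAbsTopIII2015, Def 5.4 (iii) p. 126] [cite: DupuyHilado2025, §3.4] -/
theorem cellPlus_of_mem_thetaIdele_smul (pp : Nat.Primes) [Fact (pp : ℕ).Prime] (i : Fin X.lstar) (x : (thetaIndex X).Fibre (.inr pp))
    (hx : placeOf X pp.1 x ∈ X.S) (hmem : tq pp x ∈ t pp i x • logShell (PadicLogOnUnits.ofUnitLog (pp : ℕ) (kOf X pp.1 x))) :
    CellPlus X pp i x := by
  unfold CellPlus
  by_contra hlt
  rw [not_le] at hlt
  refine qIdele_not_mem_thetaIdele_smul_logShell_of_lt X t ht0 ht tq htq0 htq pp i x hx ?_ hmem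
  rw [absRamificationIdx_kOf X pp x]
  exact hlt

include ht0 ht htq0 htq in
/-- … contrapositive, **THE DECIDED-NEG ENGINE**: `¬ CellPlus` (i.e. `slack_plus < 0`) ⟹ `t_{q,x} ∉ t_{Θ,i+1,x}·ℐ_x`. Every H⋆₇-NEG cell of the
table is an I06⋆-NEG cell. [cite: MochizukiAbsTopIII2015, Def 5.4 (iii) p. 126] -/
theorem not_mem_of_not_cellPlus (pp : Nat.Primes) [Fact (pp : ℕ).Prime] (i : Fin X.lstar) (x : (thetaIndex X).Fibre (.inr pp))
    (hx : placeOf X pp.1 x ∈ X.S) (hneg : ¬ CellPlus X pp i x) :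
    tq pp x ∉ t pp i x • logShell (PadicLogOnUnits.ofUnitLog (pp : ℕ) (kOf X pp.1 x)) := fun hmem =>
  hneg (cellPlus_of_mem_thetaIdele_smul X t ht0 ht tq htq0 htq pp i x hx hmem)

include ht0 ht htq0 htq in
/-- **H⋆₇ FROM THE REAL I06⋆ CELLS** (rp-x3 reading, all bad places and labels): H⋆₇ is a NECESSARY condition for «I06⋆ at the datum».
[cite: MochizukiAbsTopIII2015, Def 5.4 (iii) p. 126] [claim: Mochizuki2012, status: disputed] -/
theorem hStar_of_realStar
    (hstar : ∀ (pp : Nat.Primes) (i : Fin X.lstar) (x : (thetaIndex X).Fibre (.inr pp)),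
      haveI : Fact (pp : ℕ).Prime := ⟨pp.2⟩
      placeOf X pp.1 x ∈ X.S → tq pp x ∈ t pp i x • logShell (PadicLogOnUnits.ofUnitLog (pp : ℕ) (kOf X pp.1 x))) :
    HStarShellCapacityPlus X := fun pp i x hx => by
  haveI : Fact (pp : ℕ).Prime := ⟨pp.2⟩
  exact cellPlus_of_mem_thetaIdele_smul X t ht0 ht tq htq0 htq pp i x hx (hstar pp i x hx)

include htq0 htq in
/-- **NECESSITY, abc-iut-rp-d2 / w5-d068's reading**: for a REALISING q-idele, the real I06⋆ cell `t_{q,x} ∈ t_{q,x}^{(i+1)²}·ℐ_x` at a bad place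
IMPLIES H⋆₇'s cell (`CandInternal2RealLabels.height_le_of_mem_pow_smul_logShell` with `h = ord_x(q)/(2l·e_x)`).
[cite: MochizukiAbsTopIII2015, Def 5.4 (iii) p. 126] [cite: DupuyHilado2025, §3.4] -/
theorem cellPlus_of_mem_pow_smul (pp : Nat.Primes) [Fact (pp : ℕ).Prime] (i : Fin X.lstar) (x : (thetaIndex X).Fibre (.inr pp))
    (hx : placeOf X pp.1 x ∈ X.S)
    (hmem : tq pp x ∈ tq pp x ^ (((i : ℕ) + 1) ^ 2) • logShell (PadicLogOnUnits.ofUnitLog (pp : ℕ) (kOf X pp.1 x))) :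
    CellPlus X pp i x := by
  have h := height_le_of_mem_pow_smul_logShell pp (kOf X pp.1 x) (norm_qIdele_eq_rpow_of_realises X tq htq0 htq pp x hx) hmem
  rw [absRamificationIdx_kOf X pp x] at h
  unfold CellPlus
  have he : (0 : ℝ) < ((placeOf X pp.1 x).asIdeal.ramificationIdx ℤ : ℝ) := by exact_mod_cast Ideal.ramificationIdx_pos _ _
  have hl : (0 : ℝ) < X.l := by have h5 := X.five_le_l; exact_mod_cast (by omega : 0 < X.l)
  have hd : (0 : ℝ) < 2 * X.l * ((placeOf X pp.1 x).asIdeal.ramificationIdx ℤ : ℝ) := by positivity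
  have h' : ((((i : ℕ) : ℝ) + 1) ^ 2 - 1) *
      ((X.ordq (placeOf X pp.1 x) : ℝ) / (2 * X.l * ((placeOf X pp.1 x).asIdeal.ramificationIdx ℤ : ℝ))) ≤
        logRadiusB pp ((placeOf X pp.1 x).asIdeal.ramificationIdx ℤ) + ((if (pp : ℕ) = 2 then 2 else 1 : ℕ) : ℝ) := by
    have hc : ((((((i : ℕ) + 1) ^ 2 : ℕ) : ℝ)) - 1) = ((((i : ℕ) : ℝ) + 1) ^ 2 - 1) := by push_cast; ring
    rw [← hc]
    exact h
  rw [mul_div_assoc', div_le_iff₀ hd] at h'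
  linarith

include htq0 htq in
/-- **H⋆₇ FROM THE REAL I06⋆ CELLS** (rp-d2 / w5-d068 `q ∈ q^{j²}·ℐ` reading): again NECESSARY. [cite: MochizukiAbsTopIII2015, Def 5.4 (iii) p. 126]
[claim: Mochizuki2012, status: disputed] -/
theorem hStar_of_realStar_pow
    (hstar : ∀ (pp : Nat.Primes) (i : Fin X.lstar) (x : (thetaIndex X).Fibre (.inr pp)),
      haveI : Fact (pp : ℕ).Prime := ⟨pp.2⟩
      placeOf X pp.1 x ∈ X.S →
        tq pp x ∈ tq pp x ^ (((i : ℕ) + 1) ^ 2) • logShell (PadicLogOnUnits.ofUnitLog (pp : ℕ) (kOf X pp.1 x))) :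
    HStarShellCapacityPlus X := fun pp i x hx => by
  haveI : Fact (pp : ℕ).Prime := ⟨pp.2⟩
  exact cellPlus_of_mem_pow_smul X tq htq0 htq pp i x hx (hstar pp i x hx)

/-! ## §4. FAITHFULNESS: H⋆₇'s cell = the I06⋆ cell with the shell replaced by its circumscribed ball -/

include ht0 ht htq0 htq in
/-- **«I06* read with the NECESSARY-side shell radius»**: for REALISING ideles at a bad place, H⋆₇'s cell holds IFF
`t_{q,x} ∈ t_{Θ,i+1,x} · closedBall 0 (‖p*‖⁻¹·p^{b_{e_x}})` — the I06⋆ cell with `ℐ_x` replaced by the ball of [IUTchIV] Prop. 1.2 (i)'s upper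
inclusion `ℐ_x ⊆ ‖p*‖⁻¹·p^{b_e}·𝒪` (abc-iut-rp-d2 `logShell_ofUnitLog_subset_closedBall`), «the most generous shell-internal capacity».
[cite: MochizukiAbsTopIII2015, Def 5.4 (iii) p. 126] [cite: Mochizuki2012, IUTchIV Prop. 1.2 (i) p. 10] [claim: Mochizuki2012, status: disputed] -/
theorem cellPlus_iff_mem_thetaIdele_smul_closedBall (pp : Nat.Primes) [Fact (pp : ℕ).Prime] (i : Fin X.lstar)
    (x : (thetaIndex X).Fibre (.inr pp)) (hx : placeOf X pp.1 x ∈ X.S) :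
    CellPlus X pp i x ↔
      tq pp x ∈ t pp i x • closedBall (0 : kOf X pp.1 x)
        (‖(((pp : ℕ) ^ (if (pp : ℕ) = 2 then 2 else 1) : ℕ) : kOf X pp.1 x)‖⁻¹ *
          ((pp : ℕ) : ℝ) ^ logRadiusB pp (absRamificationIdx pp (kOf X pp.1 x))) := by
  have hp1 : (1 : ℝ) < (pp : ℕ) := by exact_mod_cast pp.2.one_lt
  have hp0 : (0 : ℝ) < (pp : ℕ) := by linarith
  have hun := norm_qIdele_eq_rpow_of_realises X tq htq0 htq pp x hx
  have htn := norm_thetaIdele_eq_rpow_of_realises X t ht tq htq0 htq pp i x hx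
  have he : (0 : ℝ) < ((placeOf X pp.1 x).asIdeal.ramificationIdx ℤ : ℝ) := by exact_mod_cast Ideal.ramificationIdx_pos _ _
  have hl : (0 : ℝ) < X.l := by have h5 := X.five_le_l; exact_mod_cast (by omega : 0 < X.l)
  have hd : (0 : ℝ) < 2 * X.l * ((placeOf X pp.1 x).asIdeal.ramificationIdx ℤ : ℝ) := by positivity
  set H : ℝ := (X.ordq (placeOf X pp.1 x) : ℝ) / (2 * X.l * ((placeOf X pp.1 x).asIdeal.ramificationIdx ℤ : ℝ)) with hH
  -- the norm inequality `‖t_q‖ ≤ ‖t_Θ‖ · ‖p*‖⁻¹ · p^{b}` in height form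
  have hnorm : ‖tq pp x‖ ≤ ‖t pp i x‖ * (‖(((pp : ℕ) ^ (if (pp : ℕ) = 2 then 2 else 1) : ℕ) : kOf X pp.1 x)‖⁻¹ *
        ((pp : ℕ) : ℝ) ^ logRadiusB pp (absRamificationIdx pp (kOf X pp.1 x))) ↔
      (((((i : ℕ) : ℝ) + 1) ^ 2) * H - H ≤
        logRadiusB pp (absRamificationIdx pp (kOf X pp.1 x)) + ((if (pp : ℕ) = 2 then 2 else 1 : ℕ) : ℝ)) := by
    rw [norm_pstar_inv_eq_rpow pp (kOf X pp.1 x), hun, htn, ← Real.rpow_add hp0, ← Real.rpow_add hp0, Real.rpow_le_rpow_left_iff hp1]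
    constructor <;> intro h <;> linarith
  have hcell : CellPlus X pp i x ↔ (((((i : ℕ) : ℝ) + 1) ^ 2) * H - H ≤
      logRadiusB pp (absRamificationIdx pp (kOf X pp.1 x)) + ((if (pp : ℕ) = 2 then 2 else 1 : ℕ) : ℝ)) := by
    unfold CellPlus
    rw [absRamificationIdx_kOf X pp x, show ((((i : ℕ) : ℝ) + 1) ^ 2) * H - H = ((((i : ℕ) : ℝ) + 1) ^ 2 - 1) * H by ring, hH,
      mul_div_assoc', div_le_iff₀ hd]
    constructor <;> intro h <;> linarith
  rw [hcell, ← hnorm]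
  constructor
  · intro h
    exact mem_smul_of_norm_le subset_rfl (ht0 pp i x) (by simpa [mul_assoc] using h)
  · intro h
    have := norm_le_of_mem_smul (subset_rfl : closedBall (0 : kOf X pp.1 x) _ ⊆ _) h
    simpa [mul_assoc] using this

end Realising

/-! ## §5. At print's own `K`-level pilot datum `pilotDataOfK D K` -/

section Genuine

open Thm311 Thm311.Real Cor312 Cor312Vol Cor312Prov Literature.IUT.HodgeTheaters

variable {F K Fbar : Type} [Field F] [NumberField F] [Field K] [NumberField K] [Algebra F K] [Field Fbar]
  [Algebra F Fbar] [Algebra K Fbar] {E : WeierstrassCurve F} [E.IsElliptic] {l : ℕ} {Pb : BadPlacePredicates K}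
  (D : InitialThetaData F K Fbar E l Pb)
  (t : ∀ (pp : Nat.Primes) (_ : Fin (pilotDataOfK D K).lstar) (x : (thetaIndex (pilotDataOfK D K)).Fibre (.inr pp)),
    haveI : Fact (pp : ℕ).Prime := ⟨pp.2⟩; kOf (pilotDataOfK D K) pp.1 x)
  (ht0 : ∀ pp i x, t pp i x ≠ 0)
  (ht : ∀ (pp : Nat.Primes) (i : Fin (pilotDataOfK D K).lstar) (x : (thetaIndex (pilotDataOfK D K)).Fibre (.inr pp)),
    haveI : Fact (pp : ℕ).Prime := ⟨pp.2⟩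
    Real.log ‖t pp i x‖ = -((pilotDataOfK D K).thetaPilot i (placeOf (pilotDataOfK D K) pp.1 x)) *
      logNorm K (placeOf (pilotDataOfK D K) pp.1 x) / localDegree K (placeOf (pilotDataOfK D K) pp.1 x))
  (tq : ∀ (pp : Nat.Primes) (x : (thetaIndex (pilotDataOfK D K)).Fibre (.inr pp)),
    haveI : Fact (pp : ℕ).Prime := ⟨pp.2⟩; kOf (pilotDataOfK D K) pp.1 x)
  (htq0 : ∀ pp x, tq pp x ≠ 0)
  (htq : ∀ (pp : Nat.Primes) (x : (thetaIndex (pilotDataOfK D K)).Fibre (.inr pp)),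
    haveI : Fact (pp : ℕ).Prime := ⟨pp.2⟩
    Real.log ‖tq pp x‖ = -((pilotDataOfK D K).qPilot (placeOf (pilotDataOfK D K) pp.1 x)) *
      logNorm K (placeOf (pilotDataOfK D K) pp.1 x) / localDegree K (placeOf (pilotDataOfK D K) pp.1 x))

omit t ht0 ht tq htq0 htq in
/-- **k1 DECIDER AT `pilotDataOfK D K`**: at a bad place `x | p` of `K` over `v ∈ 𝕍(F)^bad` and label `j = i+1`, H⋆₇'s cell holds IFF
`((i+1)² − 1)·e(x|v)·ord_v(q_v) ≤ 2l·capPlusW p e_x` (`ord_x(q) = e(x|v)·ord_v(q_v)`, `Cor312Prov.ordq_pilotDataOfK`; [IUTchI] Def. 3.1 (c)).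
[cite: Mochizuki2012, IUTchI Def. 3.1 (c) p. 61; IUTchIV Prop. 1.2 (i) p. 10] [claim: Mochizuki2012, status: disputed] -/
theorem cellPlus_pilotDataOfK_iff_int (pp : Nat.Primes) [Fact (pp : ℕ).Prime] (i : Fin (pilotDataOfK D K).lstar)
    (x : (thetaIndex (pilotDataOfK D K)).Fibre (.inr pp)) (hx : placeOf (pilotDataOfK D K) pp.1 x ∈ (pilotDataOfK D K).S) :
    CellPlus (pilotDataOfK D K) pp i x ↔
      ((((i : ℕ) : ℤ) + 1) ^ 2 - 1) *
          (((finBelow F K (placeOf (pilotDataOfK D K) pp.1 x)).asIdeal.ramificationIdx'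
              (placeOf (pilotDataOfK D K) pp.1 x).asIdeal : ℤ) *
            (qParamOrd E (finBelow F K (placeOf (pilotDataOfK D K) pp.1 x)) : ℤ)) ≤
        2 * l * RHAvgSlackNonneg.capPlusW pp ((placeOf (pilotDataOfK D K) pp.1 x).asIdeal.ramificationIdx ℤ) := by
  rw [cellPlus_iff_int (pilotDataOfK D K) pp i x, ordq_pilotDataOfK D K hx, pilotDataOfK_l]

include ht0 ht htq0 htq in
/-- **H⋆₇ AT `pilotDataOfK D K` FROM THE REAL I06⋆ CELLS** (realising Θ- and q-ideles of the genuine datum, abc-iut-rp-x3's reading): NECESSITY at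
the genuine datum — the k2 reading of row 7 («H* is NECESSARY for I06*, not sufficient for anything»). [cite: Mochizuki2012, IUTchI Ex. 3.2 (iv) p. 71]
[cite: MochizukiAbsTopIII2015, Def 5.4 (iii) p. 126] [claim: Mochizuki2012, status: disputed] -/
theorem hStar_pilotDataOfK_of_realStar
    (hstar : ∀ (pp : Nat.Primes) (i : Fin (pilotDataOfK D K).lstar) (x : (thetaIndex (pilotDataOfK D K)).Fibre (.inr pp)),
      haveI : Fact (pp : ℕ).Prime := ⟨pp.2⟩
      placeOf (pilotDataOfK D K) pp.1 x ∈ (pilotDataOfK D K).S →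
        tq pp x ∈ t pp i x • logShell (PadicLogOnUnits.ofUnitLog (pp : ℕ) (kOf (pilotDataOfK D K) pp.1 x))) :
    HStarShellCapacityPlus (pilotDataOfK D K) :=
  hStar_of_realStar (pilotDataOfK D K) t ht0 ht tq htq0 htq hstar

include ht0 ht htq0 htq in
/-- **… and a FAILED H⋆₇ cell at the genuine datum is a DECIDED-NEG I06⋆ cell there** (`slack_plus < 0` rows of the table).
[cite: MochizukiAbsTopIII2015, Def 5.4 (iii) p. 126] [claim: Mochizuki2012, status: disputed] -/
theorem not_mem_pilotDataOfK_of_not_cellPlus (pp : Nat.Primes) [Fact (pp : ℕ).Prime] (i : Fin (pilotDataOfK D K).lstar)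
    (x : (thetaIndex (pilotDataOfK D K)).Fibre (.inr pp)) (hx : placeOf (pilotDataOfK D K) pp.1 x ∈ (pilotDataOfK D K).S)
    (hneg : ¬ CellPlus (pilotDataOfK D K) pp i x) :
    tq pp x ∉ t pp i x • logShell (PadicLogOnUnits.ofUnitLog (pp : ℕ) (kOf (pilotDataOfK D K) pp.1 x)) :=
  not_mem_of_not_cellPlus (pilotDataOfK D K) t ht0 ht tq htq0 htq pp i x hx hneg

end Genuine

/-! ## §6. k1 kernel witnesses at the named separating cells of I06STAR-COLUMNS v1 -/

/-- `capPlusW 7 55 = 164`: at `p = 7`, `e_w = 55` (lamSeven `k = 1`, `l = 11`, local type `ev5`): `⌊log₇(385/6)⌋ = Nat.log 7 64 = 2`, `c = 1`,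
`55·(1 + 2) − 1`. [cite: Mochizuki2012, IUTchIV Prop. 1.2 p. 10] -/
theorem capPlusW_seven_fiftyfive : RHAvgSlackNonneg.capPlusW 7 55 = 164 := by
  unfold RHAvgSlackNonneg.capPlusW RHAvgSlackNonneg.eFloorLog RHAvgSlackNonneg.cExp; decide

/-- **lamSeven `k = 1`, `l = 11`, `e_w = 55` (`H = 2`, `ord_x(q) = 110`), top label `j = 5`: H⋆₇ HOLDS** — `slack_plus·(2l·e) = 22·164 − 24·110 =
968 ≥ 0` (an I06⋆-OPEN row of the table: inside the window). [cite: Mochizuki2012, IUTchIV Prop. 1.2 p. 10] -/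
theorem k1_lamSeven_k1_l11_e55_top_pos : 0 ≤ RHAvgSlackNonneg.slackPlusW2l 7 55 110 11 5 := by
  unfold RHAvgSlackNonneg.slackPlusW2l RHAvgSlackNonneg.capPlusW RHAvgSlackNonneg.eFloorLog RHAvgSlackNonneg.cExp; decide

/-- **lamSeven `k = 2`, `l = 11`, `e_w = 55` (`H = 4`, `ord_x(q) = 220`), top label `j = 5`: H⋆₇ FAILS** — `22·164 − 24·220 = −1672 < 0`
(an I06⋆-NEG row: every I06⋆-NEG datum has `slack_plus < 0` at its top label). [cite: Mochizuki2012, IUTchIV Prop. 1.2 p. 10] -/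
theorem k1_lamSeven_k2_l11_e55_top_neg : RHAvgSlackNonneg.slackPlusW2l 7 55 220 11 5 < 0 := by
  unfold RHAvgSlackNonneg.slackPlusW2l RHAvgSlackNonneg.capPlusW RHAvgSlackNonneg.eFloorLog RHAvgSlackNonneg.cExp; decide

end Summit.ABC.IUTFork.Repair.RH.ShellCapacityPlus

end
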